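import Summits.Ventures.LatticeQCDFlow.Scaling.LumpedStarStepChain
import Literature.Probability.MarkovChains.BottleneckRatio

/-!
HONEST FRAMING: exact (Metropolis-corrected) sampling algorithms for lattice gauge theory; figures
of merit are autocorrelation/cost numbers at stated couplings and volumes; no continuum-physics
claim.

# LumpedStarStepFloor — A FLOOR FOR THE LUMPED STAR'S STEP CHAIN BY TWO BUDGETS: FROM THE COMPOSITION CROWDED AT ONE CONTENT `u`, THE NUMBER OF PARTICLES MOVED OFF `u` AFTER `n`
# STEPS HAS MEAN `≤ min{n(1−σ), 1 + nσa}` (REDRAWS MOVE ONE PARTICLE EACH; BETWEEN TWO ACCEPTED SWAPS ONTO A `u`-PARTICLE — ACCEPTANCE `acc(h,u) ≤ a` — THE REDRAWS MOVE AT MOST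
# ONE PARTICLE IN TOTAL), SO `d(n) ≥ 1 − min{n(1−σ), 1+nσa}/m − π_S{fewer than m particles off u}` AND `t_mix(1/4) ≥ max{m/(4(1−σ)), (m−4)/(4σa)}` WHEN THE `u`-CROWDED COMPOSITIONS
# CARRY AT MOST HALF OF `π_S` (lean-2 GEN-44, ours)

Venture-side (OURS).  Cell `lqcd-flow` (pub-lqcd), unit `pub-lqcd-lean-2-g44`, 2026-08-31.  Chapter AD, file 6 — the floor side of the step law (files 3–5 are the ceiling
`O((K/((1−σ)σp̄))·log)`).  Objects of X5: `A` (one swap attempt: the composition does not move), `B` (the redraw: `comp' = comp − δ_{hub} + δ_{hub'}`), `S = σA + (1−σ)B`.  Two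
potentials for a fixed content `u`: `φ(x) = (K+1) − comp x(u)` (particles off `u`) and `ψ(x) = φ(x) − 𝟙{hub x ≠ u}`.  ONE-STEP FACTS: `Aφ = φ`, `Bφ ≤ φ + 1`; `Bψ = ψ` (a redraw moves the
hub particle and the hub together), `Aψ ≤ ψ + a` where `a` bounds the acceptance `acc(h,u) = min{1, W_h/W_u}` of a swap onto a `u`-particle from every other content `h` (so `a = 1`
always works, and `a = W₂/W_u` when `u` is the most persistent content); hence `Sφ ≤ φ + (1−σ)`, `Sψ ≤ ψ + σa`, and from the crowded state `x₀` (`comp = (K+1)δ_u`, `hub = u`;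
`φ = ψ = 0`, `φ ≤ ψ + 1`): `E_{x₀}φ(X_n) ≤ min{n(1−σ), 1 + nσa}`.  Markov's inequality and the event form of total variation (LPW Prop. 4.2) give the distance floor; LPW eq. (4.30) gives the mixing-time floor.

* `floor_stepLaw_expect` (`E_{μS}f = E_μ(Sf)`), `floor_swap_phi`, `floor_redraw_phi`, `floor_redraw_psi`, `floor_swap_indicator` (`A𝟙{hub = u} ≤ acc(hub,u)` off `u`), `floor_swap_psi`,
  `floor_expect_phi_le` (the two budgets),
  **`lumpedStar_step_worstTvDist_ge`**, **`lumpedStar_step_mixingTime_ge`**.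

Reading (no numerics implied): with `m ≈ (K+1)/2` the floor is `Ω(K·max{1/(1−σ), 1/(σa)}) ≥ Ω(K/(σ(1−σ)))` steps against the ceiling `O((K/((1−σ)σp̄))·log(K/(σp̄ε)))` of file 4 — the
step law of the lumped star is two-sided up to the persistence factors (`p̄` above, `a` below: heavy particles are hard to dislodge) and the logarithm.  The half-mass hypothesis on the `u`-crowded compositions is a statement about `π_S`
alone (a multinomial in `μ_1 ∝ μ_0W` reweighted by the hub factor); it holds e.g. for two contents of equal persistence and `K ≥ 15` (not typed here).  Literature grade (cell rule): OWN,
elementary on the tree's LPW files; nothing cited as a fact; no new bib keys.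
-/

open Finset
open Literature.Probability.MarkovChains

namespace Summit.Ventures.LatticeQCDFlow.Scaling

section StepFloor
variable {X : Type*} [Fintype X] [DecidableEq X] {S : Type*} [Fintype S] [DecidableEq S]
variable {hub : X → S} {comp : X → S → ℕ} {K : ℕ} {μ0 W : S → ℝ} {σ : ℝ} {acc : S → S → ℝ} {Kh : (S → ℕ) → S → S → ℝ}
variable {Ast Bst Sst : X → X → ℝ}

omit [DecidableEq X] in
/-- `E_{μP} f = E_μ (Pf)`. [ours] -/
theorem floor_stepLaw_expect (P : X → X → ℝ) (μ f : X → ℝ) : ∑ y, stepLaw P μ y * f y = ∑ x, μ x * ∑ y, P x y * f y := by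
  unfold stepLaw
  simp_rw [sum_mul, mul_sum]
  rw [sum_comm]
  exact sum_congr rfl fun x _ => sum_congr rfl fun y _ => by ring

omit [DecidableEq X] [DecidableEq S] in
/-- **`Aφ = φ`:** a swap attempt does not move the composition. [ours] -/
theorem floor_swap_phi (hA : ∀ x x', Ast x x' = if comp x' = comp x then Kh (comp x) (hub x) (hub x') else 0) (hA1 : ∀ x, ∑ x', Ast x x' = 1)
    (u : S) (x : X) : ∑ x', Ast x x' * (((K : ℝ) + 1) - (comp x' u : ℝ)) = ((K : ℝ) + 1) - (comp x u : ℝ) := by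
  have e : ∀ x', Ast x x' * (((K : ℝ) + 1) - (comp x' u : ℝ)) = Ast x x' * (((K : ℝ) + 1) - (comp x u : ℝ)) := by
    intro x'
    by_cases h : comp x' = comp x
    · rw [h]
    · rw [hA, if_neg h, zero_mul, zero_mul]
  rw [sum_congr rfl fun x' _ => e x', ← sum_mul, hA1, one_mul]

omit [DecidableEq X] in
/-- **`Bφ ≤ φ + 1`:** a redraw moves one particle. [ours] -/
theorem floor_redraw_phi (hμ0 : ∀ v, 0 ≤ μ0 v)
    (hB : ∀ x x', Bst x x' = μ0 (hub x') * (if comp x' + Pi.single (hub x) 1 = comp x + Pi.single (hub x') 1 then 1 else 0)) (hB1 : ∀ x, ∑ x', Bst x x' = 1)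
    (u : S) (x : X) : ∑ x', Bst x x' * (((K : ℝ) + 1) - (comp x' u : ℝ)) ≤ ((K : ℝ) + 1) - (comp x u : ℝ) + 1 := by
  have hB0 : ∀ x', 0 ≤ Bst x x' := fun x' => by rw [hB]; exact mul_nonneg (hμ0 _) (by split_ifs <;> norm_num)
  have e : ∀ x', Bst x x' * (((K : ℝ) + 1) - (comp x' u : ℝ)) ≤ Bst x x' * (((K : ℝ) + 1) - (comp x u : ℝ) + 1) := by
    intro x'
    by_cases h : comp x' + Pi.single (hub x) 1 = comp x + Pi.single (hub x') 1
    · refine mul_le_mul_of_nonneg_left ?_ (hB0 x')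
      have hu := congr_fun h u
      simp only [Pi.add_apply, Pi.single_apply] at hu
      have : (comp x u : ℝ) ≤ (comp x' u : ℝ) + 1 := by
        have h' : comp x u ≤ comp x' u + 1 := by split_ifs at hu <;> omega
        exact_mod_cast h'
      linarith
    · rw [hB, if_neg h, mul_zero, zero_mul, zero_mul]
  calc _ ≤ ∑ x', Bst x x' * (((K : ℝ) + 1) - (comp x u : ℝ) + 1) := sum_le_sum fun x' _ => e x'
    _ = ((K : ℝ) + 1) - (comp x u : ℝ) + 1 := by rw [← sum_mul, hB1, one_mul]

omit [DecidableEq X] in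
/-- **`Bψ = ψ`:** a redraw moves the hub particle and the hub together (`ψ = φ − 𝟙{hub ≠ u}`). [ours] -/
theorem floor_redraw_psi
    (hB : ∀ x x', Bst x x' = μ0 (hub x') * (if comp x' + Pi.single (hub x) 1 = comp x + Pi.single (hub x') 1 then 1 else 0)) (hB1 : ∀ x, ∑ x', Bst x x' = 1)
    (u : S) (x : X) :
    ∑ x', Bst x x' * (((K : ℝ) + 1) - (comp x' u : ℝ) - (if hub x' = u then (0 : ℝ) else 1))
      = ((K : ℝ) + 1) - (comp x u : ℝ) - (if hub x = u then (0 : ℝ) else 1) := by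
  have e : ∀ x', Bst x x' * (((K : ℝ) + 1) - (comp x' u : ℝ) - (if hub x' = u then (0 : ℝ) else 1))
      = Bst x x' * (((K : ℝ) + 1) - (comp x u : ℝ) - (if hub x = u then (0 : ℝ) else 1)) := by
    intro x'
    by_cases h : comp x' + Pi.single (hub x) 1 = comp x + Pi.single (hub x') 1
    · congr 1
      have hu := congr_fun h u
      simp only [Pi.add_apply, Pi.single_apply] at hu
      by_cases hx : hub x = u <;> by_cases hx' : hub x' = u
      · rw [if_pos hx, if_pos hx']
        rw [if_pos hx.symm, if_pos hx'.symm] at hu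
        rw [show comp x' u = comp x u by omega]
      · rw [if_pos hx, if_neg hx']
        rw [if_pos hx.symm, if_neg (fun e => hx' e.symm)] at hu
        have : (comp x u : ℝ) = (comp x' u : ℝ) + 1 := by exact_mod_cast (by omega : comp x u = comp x' u + 1)
        linarith
      · rw [if_neg hx, if_pos hx']
        rw [if_neg (fun e => hx e.symm), if_pos hx'.symm] at hu
        have : (comp x' u : ℝ) = (comp x u : ℝ) + 1 := by exact_mod_cast (by omega : comp x' u = comp x u + 1)
        linarith
      · rw [if_neg hx, if_neg hx']
        rw [if_neg (fun e => hx e.symm), if_neg (fun e => hx' e.symm)] at hu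
        rw [show comp x' u = comp x u by omega]
    · rw [hB, if_neg h, mul_zero, zero_mul, zero_mul]
  rw [sum_congr rfl fun x' _ => e x', ← sum_mul, hB1, one_mul]

omit [DecidableEq X] in
/-- **`A𝟙{hub = u} ≤ acc(hub x, u) ≤ a` from a hub `≠ u`:** a swap onto a `u`-particle must be proposed (`N(u)/K ≤ 1`) and accepted. [ours] -/
theorem floor_swap_indicator (hinj : ∀ x x', hub x = hub x' → comp x = comp x' → x = x')
    (hsurj : ∀ (z : S) (N : S → ℕ), ∑ v, N v = K + 1 → N z ≠ 0 → ∃ x, hub x = z ∧ comp x = N) (hhub : ∀ x, comp x (hub x) ≠ 0)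
    (hsum : ∀ x, ∑ v, comp x v = K + 1)
    (hKoff : ∀ N h v, h ≠ v → Kh N h v = if N h = 0 then 0 else (N v : ℝ) / K * acc h v)
    (hA : ∀ x x', Ast x x' = if comp x' = comp x then Kh (comp x) (hub x) (hub x') else 0)
    (u : S) {a : ℝ} (ha0 : 0 ≤ a) (ha : ∀ h, h ≠ u → acc h u ≤ a) (x : X) (hx : hub x ≠ u) :
    ∑ x', Ast x x' * (if hub x' = u then (1 : ℝ) else 0) ≤ a := by
  classical
  have e : ∑ x', Ast x x' * (if hub x' = u then (1 : ℝ) else 0)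
      = ∑ x', (if comp x' = comp x then (fun v => Kh (comp x) (hub x) v * (if v = u then (1 : ℝ) else 0)) (hub x') else 0) := by
    refine sum_congr rfl fun x' _ => ?_
    rw [hA]
    by_cases hc : comp x' = comp x
    · rw [if_pos hc, if_pos hc]
    · rw [if_neg hc, if_neg hc, zero_mul]
  rw [e, star_sum_fiber hinj hsurj hhub (comp x) (hsum x) (fun v => Kh (comp x) (hub x) v * (if v = u then (1 : ℝ) else 0))]
  simp only [mul_ite, mul_one, mul_zero]
  rw [show (∑ v, if comp x v = 0 then (0 : ℝ) else if v = u then Kh (comp x) (hub x) v else 0) = ∑ v, (if v = u then (if comp x u = 0 then 0 else Kh (comp x) (hub x) u) else 0) from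
    sum_congr rfl fun v _ => by by_cases hv : v = u <;> simp [hv], Finset.sum_ite_eq' univ u, if_pos (mem_univ _)]
  by_cases hu0 : comp x u = 0
  · rw [if_pos hu0]; exact ha0
  · rw [if_neg hu0, hKoff (comp x) (hub x) u hx, if_neg (hhub x)]
    -- `N(u) ≤ K` since the hub content `≠ u` is present
    have hNu : (comp x u : ℝ) / K ≤ 1 := by
      have h1 : comp x u + comp x (hub x) ≤ K + 1 := by
        rw [← hsum x, ← Finset.sum_pair (Ne.symm hx)]
        exact Finset.sum_le_sum_of_subset_of_nonneg (subset_univ _) fun _ _ _ => Nat.zero_le _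
      have h2 : 1 ≤ comp x (hub x) := Nat.one_le_iff_ne_zero.mpr (hhub x)
      have h3 : 1 ≤ comp x u := Nat.one_le_iff_ne_zero.mpr hu0
      have hKpos : 0 < K := by omega
      rw [div_le_one (by exact_mod_cast hKpos)]; exact_mod_cast (by omega : comp x u ≤ K)
    have hNu0 : 0 ≤ (comp x u : ℝ) / K := div_nonneg (Nat.cast_nonneg _) (Nat.cast_nonneg _)
    calc (comp x u : ℝ) / K * acc (hub x) u ≤ (comp x u : ℝ) / K * a := mul_le_mul_of_nonneg_left (ha (hub x) hx) hNu0
      _ ≤ 1 * a := mul_le_mul_of_nonneg_right hNu ha0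
      _ = a := one_mul a

omit [DecidableEq X] in
/-- **`Aψ ≤ ψ + a`:** a swap attempt keeps the composition and moves the hub onto a `u`-particle with probability `≤ a`. [ours] -/
theorem floor_swap_psi (hinj : ∀ x x', hub x = hub x' → comp x = comp x' → x = x')
    (hsurj : ∀ (z : S) (N : S → ℕ), ∑ v, N v = K + 1 → N z ≠ 0 → ∃ x, hub x = z ∧ comp x = N) (hhub : ∀ x, comp x (hub x) ≠ 0)
    (hsum : ∀ x, ∑ v, comp x v = K + 1)
    (hKoff : ∀ N h v, h ≠ v → Kh N h v = if N h = 0 then 0 else (N v : ℝ) / K * acc h v)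
    (hA : ∀ x x', Ast x x' = if comp x' = comp x then Kh (comp x) (hub x) (hub x') else 0) (hA0 : ∀ x x', 0 ≤ Ast x x')
    (hA1 : ∀ x, ∑ x', Ast x x' = 1) (u : S) {a : ℝ} (ha0 : 0 ≤ a) (ha : ∀ h, h ≠ u → acc h u ≤ a) (x : X) :
    ∑ x', Ast x x' * (((K : ℝ) + 1) - (comp x' u : ℝ) - (if hub x' = u then (0 : ℝ) else 1))
      ≤ ((K : ℝ) + 1) - (comp x u : ℝ) - (if hub x = u then (0 : ℝ) else 1) + a := by
  -- `Aψ = φ − 1 + A𝟙{hub = u}`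
  have e : ∀ x', Ast x x' * (((K : ℝ) + 1) - (comp x' u : ℝ) - (if hub x' = u then (0 : ℝ) else 1))
      = Ast x x' * (((K : ℝ) + 1) - (comp x u : ℝ) - 1) + Ast x x' * (if hub x' = u then (1 : ℝ) else 0) := by
    intro x'
    by_cases h : comp x' = comp x
    · rw [h]; split_ifs <;> ring
    · rw [hA, if_neg h]; ring
  rw [sum_congr rfl fun x' _ => e x', sum_add_distrib, ← sum_mul, hA1, one_mul]
  by_cases hx : hub x = u
  · rw [if_pos hx]
    have : ∑ x', Ast x x' * (if hub x' = u then (1 : ℝ) else 0) ≤ 1 := by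
      calc _ ≤ ∑ x', Ast x x' := sum_le_sum fun x' _ => by split_ifs <;> nlinarith [hA0 x x']
        _ = 1 := hA1 x
    linarith
  · rw [if_neg hx]
    have := floor_swap_indicator hinj hsurj hhub hsum hKoff hA u ha0 ha x hx
    linarith

omit [DecidableEq X] in
/-- **THE TWO BUDGETS:** from any start law `μ`, `E_{μSⁿ}φ ≤ E_μφ + n(1−σ)` and `E_{μSⁿ}ψ ≤ E_μψ + nσ`. [ours] -/
theorem floor_expect_phi_le (hinj : ∀ x x', hub x = hub x' → comp x = comp x' → x = x')
    (hsurj : ∀ (z : S) (N : S → ℕ), ∑ v, N v = K + 1 → N z ≠ 0 → ∃ x, hub x = z ∧ comp x = N) (hhub : ∀ x, comp x (hub x) ≠ 0)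
    (hsum : ∀ x, ∑ v, comp x v = K + 1)
    (hKoff : ∀ N h v, h ≠ v → Kh N h v = if N h = 0 then 0 else (N v : ℝ) / K * acc h v)
    (hμ0 : ∀ v, 0 ≤ μ0 v) (hσ0 : 0 ≤ σ) (hσ1 : σ ≤ 1)
    (hA : ∀ x x', Ast x x' = if comp x' = comp x then Kh (comp x) (hub x) (hub x') else 0) (hA0 : ∀ x x', 0 ≤ Ast x x') (hA1 : ∀ x, ∑ x', Ast x x' = 1)
    (hB : ∀ x x', Bst x x' = μ0 (hub x') * (if comp x' + Pi.single (hub x) 1 = comp x + Pi.single (hub x') 1 then 1 else 0)) (hB1 : ∀ x, ∑ x', Bst x x' = 1)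
    (hS : ∀ x x', Sst x x' = σ * Ast x x' + (1 - σ) * Bst x x') (u : S) {a : ℝ} (ha0 : 0 ≤ a) (ha : ∀ h, h ≠ u → acc h u ≤ a)
    {μ : X → ℝ} (hμ : ∀ x, 0 ≤ μ x) (n : ℕ) :
    ∑ y, lawAt Sst μ n y * (((K : ℝ) + 1) - (comp y u : ℝ)) ≤ ∑ x, μ x * (((K : ℝ) + 1) - (comp x u : ℝ)) + n * (1 - σ) * ∑ x, μ x
    ∧ ∑ y, lawAt Sst μ n y * (((K : ℝ) + 1) - (comp y u : ℝ) - (if hub y = u then (0 : ℝ) else 1))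
        ≤ ∑ x, μ x * (((K : ℝ) + 1) - (comp x u : ℝ) - (if hub x = u then (0 : ℝ) else 1)) + n * (σ * a) * ∑ x, μ x := by
  have hB0 : ∀ x x', 0 ≤ Bst x x' := fun x x' => by rw [hB]; exact mul_nonneg (hμ0 _) (by split_ifs <;> norm_num)
  have hSrs : IsRowStochastic Sst := by
    refine ⟨fun x y => by rw [hS]; exact add_nonneg (mul_nonneg hσ0 (hA0 x y)) (mul_nonneg (by linarith) (hB0 x y)), fun x => ?_⟩
    simp_rw [hS]; rw [sum_add_distrib, ← mul_sum, ← mul_sum, hA1, hB1]; ring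
  -- one step on the two potentials
  have hSφ : ∀ x, ∑ y, Sst x y * (((K : ℝ) + 1) - (comp y u : ℝ)) ≤ ((K : ℝ) + 1) - (comp x u : ℝ) + (1 - σ) := by
    intro x
    have e : ∑ y, Sst x y * (((K : ℝ) + 1) - (comp y u : ℝ)) = σ * ∑ y, Ast x y * (((K : ℝ) + 1) - (comp y u : ℝ)) + (1 - σ) * ∑ y, Bst x y * (((K : ℝ) + 1) - (comp y u : ℝ)) := by
      simp_rw [hS, add_mul, sum_add_distrib, mul_assoc, ← mul_sum]
    rw [e, floor_swap_phi hA hA1 u x]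
    have := floor_redraw_phi (K := K) hμ0 hB hB1 u x
    nlinarith [this, hσ1]
  have hSψ : ∀ x, ∑ y, Sst x y * (((K : ℝ) + 1) - (comp y u : ℝ) - (if hub y = u then (0 : ℝ) else 1))
      ≤ ((K : ℝ) + 1) - (comp x u : ℝ) - (if hub x = u then (0 : ℝ) else 1) + σ * a := by
    intro x
    have e : ∑ y, Sst x y * (((K : ℝ) + 1) - (comp y u : ℝ) - (if hub y = u then (0 : ℝ) else 1))
        = σ * ∑ y, Ast x y * (((K : ℝ) + 1) - (comp y u : ℝ) - (if hub y = u then (0 : ℝ) else 1))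
          + (1 - σ) * ∑ y, Bst x y * (((K : ℝ) + 1) - (comp y u : ℝ) - (if hub y = u then (0 : ℝ) else 1)) := by
      simp_rw [hS, add_mul, sum_add_distrib, mul_assoc, ← mul_sum]
    rw [e, floor_redraw_psi (K := K) hB hB1 u x]
    have := floor_swap_psi hinj hsurj hhub hsum hKoff hA hA0 hA1 u ha0 ha x
    nlinarith [this, hσ0]
  -- iterate
  induction n with
  | zero => simp [lawAt_zero]
  | succ n ih =>
      have hmass : ∑ y, lawAt Sst μ n y = ∑ x, μ x := sum_lawAt hSrs μ n
      have hl0 : ∀ y, 0 ≤ lawAt Sst μ n y := lawAt_nonneg hSrs hμ n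
      obtain ⟨ih1, ih2⟩ := ih
      refine ⟨?_, ?_⟩
      · rw [lawAt_succ, floor_stepLaw_expect]
        calc ∑ x, lawAt Sst μ n x * ∑ y, Sst x y * (((K : ℝ) + 1) - (comp y u : ℝ))
            ≤ ∑ x, lawAt Sst μ n x * (((K : ℝ) + 1) - (comp x u : ℝ) + (1 - σ)) := sum_le_sum fun x _ => mul_le_mul_of_nonneg_left (hSφ x) (hl0 x)
          _ = ∑ x, lawAt Sst μ n x * (((K : ℝ) + 1) - (comp x u : ℝ)) + (1 - σ) * ∑ x, lawAt Sst μ n x := by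
              rw [mul_sum, ← sum_add_distrib]; exact sum_congr rfl fun x _ => by ring
          _ ≤ _ := by rw [hmass]; push_cast; nlinarith [ih1]
      · rw [lawAt_succ, floor_stepLaw_expect]
        calc ∑ x, lawAt Sst μ n x * ∑ y, Sst x y * (((K : ℝ) + 1) - (comp y u : ℝ) - (if hub y = u then (0 : ℝ) else 1))
            ≤ ∑ x, lawAt Sst μ n x * (((K : ℝ) + 1) - (comp x u : ℝ) - (if hub x = u then (0 : ℝ) else 1) + σ * a) :=
              sum_le_sum fun x _ => mul_le_mul_of_nonneg_left (hSψ x) (hl0 x)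
          _ = ∑ x, lawAt Sst μ n x * (((K : ℝ) + 1) - (comp x u : ℝ) - (if hub x = u then (0 : ℝ) else 1)) + σ * a * ∑ x, lawAt Sst μ n x := by
              rw [mul_sum, ← sum_add_distrib]; exact sum_congr rfl fun x _ => by ring
          _ ≤ _ := by rw [hmass]; push_cast; nlinarith [ih2]

/-- **THE DISTANCE FLOOR:** from the composition crowded at `u`, for every `m > 0` and every `n`,
`d(n) ≥ 1 − min{n(1−σ), 1+nσ}/m − π{x : fewer than m particles off u}` (any `π` of unit mass). [ours] -/
theorem lumpedStar_step_worstTvDist_ge (hinj : ∀ x x', hub x = hub x' → comp x = comp x' → x = x')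
    (hsurj : ∀ (z : S) (N : S → ℕ), ∑ v, N v = K + 1 → N z ≠ 0 → ∃ x, hub x = z ∧ comp x = N) (hhub : ∀ x, comp x (hub x) ≠ 0)
    (hsum : ∀ x, ∑ v, comp x v = K + 1)
    (hKoff : ∀ N h v, h ≠ v → Kh N h v = if N h = 0 then 0 else (N v : ℝ) / K * acc h v)
    (hμ0 : ∀ v, 0 ≤ μ0 v) (hσ0 : 0 ≤ σ) (hσ1 : σ ≤ 1)
    (hA : ∀ x x', Ast x x' = if comp x' = comp x then Kh (comp x) (hub x) (hub x') else 0) (hA0 : ∀ x x', 0 ≤ Ast x x') (hA1 : ∀ x, ∑ x', Ast x x' = 1)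
    (hB : ∀ x x', Bst x x' = μ0 (hub x') * (if comp x' + Pi.single (hub x) 1 = comp x + Pi.single (hub x') 1 then 1 else 0)) (hB1 : ∀ x, ∑ x', Bst x x' = 1)
    (hS : ∀ x x', Sst x x' = σ * Ast x x' + (1 - σ) * Bst x x') {π : X → ℝ} (hπ1 : ∑ x, π x = 1)
    (u : S) {a : ℝ} (ha0 : 0 ≤ a) (ha : ∀ h, h ≠ u → acc h u ≤ a) {m : ℝ} (hm : 0 < m) (n : ℕ) :
    1 - min ((n : ℝ) * (1 - σ)) (1 + n * (σ * a)) / m - ∑ x ∈ univ.filter (fun x => ((K : ℝ) + 1) - (comp x u : ℝ) < m), π x ≤ worstTvDist Sst π n := by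
  classical
  -- the crowded start
  obtain ⟨x₀, hx₀h, hx₀c⟩ := hsurj u (fun v => if v = u then K + 1 else 0) (by rw [Finset.sum_ite_eq' univ u]; simp) (by simp)
  have hB0 : ∀ x x', 0 ≤ Bst x x' := fun x x' => by rw [hB]; exact mul_nonneg (hμ0 _) (by split_ifs <;> norm_num)
  have hSrs : IsRowStochastic Sst := by
    refine ⟨fun x y => by rw [hS]; exact add_nonneg (mul_nonneg hσ0 (hA0 x y)) (mul_nonneg (by linarith) (hB0 x y)), fun x => ?_⟩
    simp_rw [hS]; rw [sum_add_distrib, ← mul_sum, ← mul_sum, hA1, hB1]; ring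
  set μ : X → ℝ := Pi.single x₀ 1 with hμdef
  have hμ0' : ∀ x, 0 ≤ μ x := fun x => by rw [hμdef]; by_cases h : x = x₀ <;> simp [h]
  have hμ1 : ∑ x, μ x = 1 := by rw [hμdef]; simp
  have hl0 : ∀ y, 0 ≤ lawAt Sst μ n y := lawAt_nonneg hSrs hμ0' n
  have hl1 : ∑ y, lawAt Sst μ n y = 1 := by rw [sum_lawAt hSrs μ n, hμ1]
  -- the two budgets at the crowded start
  have hφ0 : ∑ x, μ x * (((K : ℝ) + 1) - (comp x u : ℝ)) = 0 := by
    rw [hμdef, Finset.sum_eq_single x₀ (fun x _ hx => by simp [hx]) (fun h => absurd (mem_univ _) h)]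
    simp [hx₀c]
  have hψ0 : ∑ x, μ x * (((K : ℝ) + 1) - (comp x u : ℝ) - (if hub x = u then (0 : ℝ) else 1)) = 0 := by
    rw [hμdef, Finset.sum_eq_single x₀ (fun x _ hx => by simp [hx]) (fun h => absurd (mem_univ _) h)]
    simp [hx₀c, hx₀h]
  obtain ⟨hE1, hE2⟩ := floor_expect_phi_le hinj hsurj hhub hsum hKoff hμ0 hσ0 hσ1 hA hA0 hA1 hB hB1 hS u ha0 ha hμ0' n
  rw [hφ0, hμ1] at hE1; rw [hψ0, hμ1] at hE2
  have hEφ : ∑ y, lawAt Sst μ n y * (((K : ℝ) + 1) - (comp y u : ℝ)) ≤ min ((n : ℝ) * (1 - σ)) (1 + n * (σ * a)) := by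
    refine le_min (by linarith) ?_
    have : ∑ y, lawAt Sst μ n y * (((K : ℝ) + 1) - (comp y u : ℝ))
        ≤ ∑ y, lawAt Sst μ n y * (((K : ℝ) + 1) - (comp y u : ℝ) - (if hub y = u then (0 : ℝ) else 1)) + ∑ y, lawAt Sst μ n y := by
      rw [← sum_add_distrib]; exact sum_le_sum fun y _ => by split_ifs <;> nlinarith [hl0 y]
    rw [hl1] at this; linarith
  -- Markov on the event `{φ ≥ m}`
  have hφnn : ∀ y, 0 ≤ ((K : ℝ) + 1) - (comp y u : ℝ) := fun y => by
    have h := single_le_sum (f := fun v => comp y v) (fun v _ => Nat.zero_le _) (mem_univ u); rw [hsum y] at h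
    have : (comp y u : ℝ) ≤ K + 1 := by exact_mod_cast h
    linarith
  have hMarkov : m * ∑ y ∈ univ.filter (fun y => ¬ (((K : ℝ) + 1) - (comp y u : ℝ) < m)), lawAt Sst μ n y ≤ min ((n : ℝ) * (1 - σ)) (1 + n * (σ * a)) := by
    refine le_trans ?_ hEφ
    rw [mul_sum, ← Finset.sum_filter_add_sum_filter_not univ (fun y => ((K : ℝ) + 1) - (comp y u : ℝ) < m)]
    have h1 : 0 ≤ ∑ y ∈ univ.filter (fun y => ((K : ℝ) + 1) - (comp y u : ℝ) < m), lawAt Sst μ n y * (((K : ℝ) + 1) - (comp y u : ℝ)) :=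
      sum_nonneg fun y _ => mul_nonneg (hl0 y) (hφnn y)
    have h2 : ∑ y ∈ univ.filter (fun y => ¬ (((K : ℝ) + 1) - (comp y u : ℝ) < m)), m * lawAt Sst μ n y
        ≤ ∑ y ∈ univ.filter (fun y => ¬ (((K : ℝ) + 1) - (comp y u : ℝ) < m)), lawAt Sst μ n y * (((K : ℝ) + 1) - (comp y u : ℝ)) :=
      sum_le_sum fun y hy => by rw [mul_comm]; exact mul_le_mul_of_nonneg_left (not_lt.mp (mem_filter.mp hy).2) (hl0 y)
    linarith
  -- the mass of the good event under the law at time `n`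
  have hgood : 1 - min ((n : ℝ) * (1 - σ)) (1 + n * (σ * a)) / m ≤ ∑ y ∈ univ.filter (fun y => ((K : ℝ) + 1) - (comp y u : ℝ) < m), lawAt Sst μ n y := by
    have hsplit := Finset.sum_filter_add_sum_filter_not univ (fun y => ((K : ℝ) + 1) - (comp y u : ℝ) < m) (fun y => lawAt Sst μ n y)
    rw [hl1] at hsplit
    have hbad : ∑ y ∈ univ.filter (fun y => ¬ (((K : ℝ) + 1) - (comp y u : ℝ) < m)), lawAt Sst μ n y ≤ min ((n : ℝ) * (1 - σ)) (1 + n * (σ * a)) / m := by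
      rw [le_div_iff₀ hm, mul_comm]; exact hMarkov
    linarith
  -- total variation, event form
  have htv := sub_sum_le_tvDist (μ := lawAt Sst μ n) (ν := π) (by rw [hl1, hπ1]) (univ.filter (fun y => ((K : ℝ) + 1) - (comp y u : ℝ) < m))
  have hw := tvDist_single_le_worstTvDist Sst π n x₀
  rw [← hμdef] at hw
  linarith

/-- **THE MIXING-TIME FLOOR:** if the `u`-crowded compositions `{x : fewer than m particles off u}` carry at most half of `π_S` and the chain is `¼`-close at some time, then
`t_mix(1/4) ≥ m/(4(1−σ))` (for `σ < 1`) and `t_mix(1/4) ≥ (m−4)/(4σa)` (for `σa > 0`). [ours] -/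
theorem lumpedStar_step_mixingTime_ge (hinj : ∀ x x', hub x = hub x' → comp x = comp x' → x = x')
    (hsurj : ∀ (z : S) (N : S → ℕ), ∑ v, N v = K + 1 → N z ≠ 0 → ∃ x, hub x = z ∧ comp x = N) (hhub : ∀ x, comp x (hub x) ≠ 0)
    (hsum : ∀ x, ∑ v, comp x v = K + 1)
    (hKoff : ∀ N h v, h ≠ v → Kh N h v = if N h = 0 then 0 else (N v : ℝ) / K * acc h v)
    (hμ0 : ∀ v, 0 ≤ μ0 v) (hσ0 : 0 ≤ σ) (hσ1 : σ ≤ 1)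
    (hA : ∀ x x', Ast x x' = if comp x' = comp x then Kh (comp x) (hub x) (hub x') else 0) (hA0 : ∀ x x', 0 ≤ Ast x x') (hA1 : ∀ x, ∑ x', Ast x x' = 1)
    (hB : ∀ x x', Bst x x' = μ0 (hub x') * (if comp x' + Pi.single (hub x) 1 = comp x + Pi.single (hub x') 1 then 1 else 0)) (hB1 : ∀ x, ∑ x', Bst x x' = 1)
    (hS : ∀ x x', Sst x x' = σ * Ast x x' + (1 - σ) * Bst x x') {π : X → ℝ} (hπ1 : ∑ x, π x = 1) (hst : IsStationary π Sst)
    (u : S) {a : ℝ} (ha0 : 0 ≤ a) (ha : ∀ h, h ≠ u → acc h u ≤ a) {m : ℝ} (hm : 0 < m)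
    (hhalf : ∑ x ∈ univ.filter (fun x => ((K : ℝ) + 1) - (comp x u : ℝ) < m), π x ≤ 1 / 2)
    (hmix : ∃ t₀, worstTvDist Sst π t₀ ≤ 1 / 4) :
    (σ < 1 → m / (4 * (1 - σ)) ≤ (mixingTime Sst π (1 / 4) : ℝ)) ∧ (0 < σ * a → (m - 4) / (4 * (σ * a)) ≤ (mixingTime Sst π (1 / 4) : ℝ)) := by
  classical
  have hB0 : ∀ x x', 0 ≤ Bst x x' := fun x x' => by rw [hB]; exact mul_nonneg (hμ0 _) (by split_ifs <;> norm_num)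
  have hSrs : IsRowStochastic Sst := by
    refine ⟨fun x y => by rw [hS]; exact add_nonneg (mul_nonneg hσ0 (hA0 x y)) (mul_nonneg (by linarith) (hB0 x y)), fun x => ?_⟩
    simp_rw [hS]; rw [sum_add_distrib, ← mul_sum, ← mul_sum, hA1, hB1]; ring
  set n := mixingTime Sst π (1 / 4) with hn
  obtain ⟨t₀, ht₀⟩ := hmix
  have hd : worstTvDist Sst π n ≤ 1 / 4 := worstTvDist_le_of_mixingTime_le hSrs hst ht₀ le_rfl
  have hfloor := lumpedStar_step_worstTvDist_ge hinj hsurj hhub hsum hKoff hμ0 hσ0 hσ1 hA hA0 hA1 hB hB1 hS hπ1 u ha0 ha hm n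
  -- so `min{n(1−σ), 1+nσa} ≥ m/4`
  have hq : m / 4 ≤ min ((n : ℝ) * (1 - σ)) (1 + n * (σ * a)) := by
    have h1 : 1 / 4 ≤ min ((n : ℝ) * (1 - σ)) (1 + n * (σ * a)) / m := by linarith
    rw [le_div_iff₀ hm] at h1; linarith
  have hq1 := hq.trans (min_le_left _ _)
  have hq2 := hq.trans (min_le_right _ _)
  refine ⟨fun hσ => ?_, fun hσ => ?_⟩
  · rw [div_le_iff₀ (by linarith)]; linarith
  · rw [div_le_iff₀ (by linarith)]; linarith

end StepFloor

end Summit.Ventures.LatticeQCDFlow.Scaling
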